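import Summits.AtomisticToContinuum.FouriersLaw.Theorems.VanishingNoiseTransferNoiseLocalityStubResponseDensityNoisyAux7

/-!
# The deterministic response-density stub from the a priori bound alone
(helpers for stubs `stub_responseDensityNoisy` / `stub_responseDensityDet`)

Helper file `--supports stmt-AtomisticToContinuum-11975` (crux `NoiseLocality`, route
`VanishingNoiseTransfer`, line `relative-flip-energy-transfer`).

The `L²(μ_T)`-Liouville theorem of the previous file (`ae_eq_zero_of_weak_generator`) is exactly the
uniqueness input of the compactness reduction `of_apriori_of_unique` AT RATE `ε = 0`, where a flip steady
state is a deterministic weak steady state (`OscillatorChain.isFlipSteadyState_zero_iff`,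
`OscillatorChain.flipGenerator_zero`). Hence (`det_of_apriori`, registered helper
`helper_responseDensityNoisyDetOfApriori`): **the DETERMINISTIC stub `stub_responseDensityDet` for
`N ≥ 2` also follows from its a priori `L²(μ_T)` linear-response bound alone** — for small `δ ≠ 0` the
unique weak steady state `μ_δ = μ (T+δ/2) (T-δ/2)` has `dμ_δ/dμ_T = 1 + δ k_δ` with `∫ k_δ² dμ_T ≤ C`
(the `L²` part of sibling item stmt-AtomisticToContinuum-9144 `ResponseDensity`; no identification of the
limit is needed any more). No definitions.
-/

noncomputable section

open MeasureTheory Filter Topology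
open scoped ContDiff

namespace Summit.AtomisticToContinuum.FouriersLaw.Theorems.NoiseLocality.StubResponseDensityNoisy

open Literature.MathematicalPhysics.KineticTheory.HeatConduction

variable {ω₂ lam β γ : ℝ} {N : ℕ} {T : ℝ}

/-- **The deterministic response-density stub for `N ≥ 2` from the a priori `L²(μ_T)` bound alone.** For
the pinned chain (`ω₂, β, γ, T > 0`, `lam ≥ 0`, `N ≥ 2`) and a family `μ` of weak steady states
(`IsSteadyState`) unique at every pair of positive temperatures: the a priori bound
`dμ_δ/dμ_T = 1 + δ k_δ`, `∫ k_δ² dμ_T ≤ C` for small `δ ≠ 0` implies the existence of the `L²(μ_T)` response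
density with the `HasDerivAt` clauses (rate `ε = 0` in `of_apriori_of_unique`, uniqueness by
`ae_eq_zero_of_weak_generator`). -/
theorem det_of_apriori (hω : 0 < ω₂) (hl : 0 ≤ lam) (hβ : 0 < β) (hγ : 0 < γ) (hN : 2 ≤ N) (hT : 0 < T)
    (μ : ℝ → ℝ → Measure (PhaseSpace N))
    (hμ : ∀ T_L T_R : ℝ, 0 < T_L → 0 < T_R →
      (pinnedChain ω₂ lam β γ).IsSteadyState N T_L T_R (μ T_L T_R) ∧
        ∀ ν : Measure (PhaseSpace N),
          (pinnedChain ω₂ lam β γ).IsSteadyState N T_L T_R ν → ν = μ T_L T_R)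
    (hA : ∃ C : ℝ, ∀ᶠ δ in 𝓝[≠] (0 : ℝ), ∃ k : PhaseSpace N → ℝ,
      MemLp k 2 ((pinnedChain ω₂ lam β γ).gibbsMeasure N T) ∧
        ∫ x, k x ^ 2 ∂((pinnedChain ω₂ lam β γ).gibbsMeasure N T) ≤ C ∧
        ∀ F : PhaseSpace N → ℝ, MemLp F 2 ((pinnedChain ω₂ lam β γ).gibbsMeasure N T) →
          Integrable F (μ (T + δ / 2) (T - δ / 2)) ∧
            ∫ x, F x ∂(μ (T + δ / 2) (T - δ / 2)) =
              ∫ x, F x ∂((pinnedChain ω₂ lam β γ).gibbsMeasure N T) +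
                δ * ∫ x, F x * k x ∂((pinnedChain ω₂ lam β γ).gibbsMeasure N T)) :
    ∃ U : PhaseSpace N → ℝ,
      MemLp U 2 ((pinnedChain ω₂ lam β γ).gibbsMeasure N T) ∧
        (∀ g : PhaseSpace N → ℝ, ContDiff ℝ ((⊤ : ℕ∞) : WithTop ℕ∞) g → HasCompactSupport g →
            HasDerivAt (fun δ : ℝ => ∫ x, g x ∂(μ (T + δ / 2) (T - δ / 2)))
              (∫ x, g x * U x ∂((pinnedChain ω₂ lam β γ).gibbsMeasure N T)) 0) ∧
        HasDerivAt (fun δ : ℝ => (pinnedChain ω₂ lam β γ).totalCurrent (μ (T + δ / 2) (T - δ / 2)))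
          (∑ i : Fin N, ∫ x, (pinnedChain ω₂ lam β γ).bondCurrent N i x * U x
            ∂((pinnedChain ω₂ lam β γ).gibbsMeasure N T)) 0 := by
  have hμ' : ∀ T_L T_R : ℝ, 0 < T_L → 0 < T_R →
      (pinnedChain ω₂ lam β γ).IsFlipSteadyState N T_L T_R 0 (μ T_L T_R) ∧
        ∀ ν : Measure (PhaseSpace N),
          (pinnedChain ω₂ lam β γ).IsFlipSteadyState N T_L T_R 0 ν → ν = μ T_L T_R := by
    intro T_L T_R hL hR
    simp only [OscillatorChain.isFlipSteadyState_zero_iff]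
    exact hμ T_L T_R hL hR
  exact of_apriori_of_unique hω hl hβ.le γ N hT 0 μ hμ' hA fun k hk hk0 hkw =>
    ae_eq_zero_of_weak_generator hω hl hβ hγ hN hT hk hk0 fun F hF hFc => by
      have h := hkw F hF hFc
      simpa only [OscillatorChain.flipGenerator_zero] using h

/-! ### Registered helper sub-goal (stub form, one line) -/

/-- Registered helper sub-goal `helper_responseDensityNoisyDetOfApriori` (= `det_of_apriori` in stub form):
the deterministic response-density stub for `N ≥ 2` from its a priori `L²(μ_T)` linear-response bound. -/
theorem helper_responseDensityNoisyDetOfApriori : ∀ ω₂ lam β γ : ℝ, 0 < ω₂ → 0 ≤ lam → 0 < β → 0 < γ → ∀ (N : ℕ), 2 ≤ N → ∀ (T : ℝ), 0 < T → ∀ (μ : ℝ → ℝ → MeasureTheory.Measure (Literature.MathematicalPhysics.KineticTheory.HeatConduction.PhaseSpace N)), (∀ T_L T_R : ℝ, 0 < T_L → 0 < T_R → (Literature.MathematicalPhysics.KineticTheory.HeatConduction.pinnedChain ω₂ lam β γ).IsSteadyState N T_L T_R (μ T_L T_R) ∧ ∀ ν : MeasureTheory.Measure (Literature.MathematicalPhysics.KineticTheory.HeatConduction.PhaseSpace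 N), (Literature.MathematicalPhysics.KineticTheory.HeatConduction.pinnedChain ω₂ lam β γ).IsSteadyState N T_L T_R ν → ν = μ T_L T_R) → (∃ C : ℝ, ∀ᶠ δ in nhdsWithin (0 : ℝ) {(0 : ℝ)}ᶜ, ∃ k : Literature.MathematicalPhysics.KineticTheory.HeatConduction.PhaseSpace N → ℝ, MeasureTheory.MemLp k 2 ((Literature.MathematicalPhysics.KineticTheory.HeatConduction.pinnedChain ω₂ lam β γ).gibbsMeasure N T) ∧ ∫ x, k x ^ 2 ∂((Literature.MathematicalPhysics.KineticTheory.HeatConduction.pinnedChain ω₂ lam β γ).gibbsMeasure N T) ≤ C ∧ ∀ F : Literature.MathematicalPhysics.KineticTheory.HeatConduction.PhaseSpace N → ℝ, MeasureTheory.MemLp F 2 ((Literature.MathematicalPhysics.KineticTheory.HeatConduction.pinnedChain ω₂ lam β γ).gibbsMeasure N T) → MeasureTheory.Integrable F (μ (T + δ / 2) (T - δ / 2)) ∧ ∫ x, F x ∂(μ (T + δ / 2) (T - δ / 2)) = ∫ x, F x ∂((Literature.MathematicalPhysics.KineticTheory.HeatConduction.pinnedChain ω₂ lam β γ).gibbsMeasure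 N T) + δ * ∫ x, F x * k x ∂((Literature.MathematicalPhysics.KineticTheory.HeatConduction.pinnedChain ω₂ lam β γ).gibbsMeasure N T)) → ∃ U : Literature.MathematicalPhysics.KineticTheory.HeatConduction.PhaseSpace N → ℝ, MeasureTheory.MemLp U 2 ((Literature.MathematicalPhysics.KineticTheory.HeatConduction.pinnedChain ω₂ lam β γ).gibbsMeasure N T) ∧ (∀ g : Literature.MathematicalPhysics.KineticTheory.HeatConduction.PhaseSpace N → ℝ, ContDiff ℝ ((⊤ : ℕ∞) : WithTop ℕ∞) g → HasCompactSupport g → HasDerivAt (fun δ : ℝ => ∫ x, g x ∂(μ (T + δ / 2) (T - δ / 2))) (∫ x, g x * U x ∂((Literature.MathematicalPhysics.KineticTheory.HeatConduction.pinnedChain ω₂ lam β γ).gibbsMeasure N T)) 0) ∧ HasDerivAt (fun δ : ℝ => (Literature.MathematicalPhysics.KineticTheory.HeatConduction.pinnedChain ω₂ lam β γ).totalCurrent (μ (T + δ / 2) (T - δ / 2))) (∑ i : Fin N, ∫ x, (Literature.MathematicalPhysics.KineticTheory.HeatConduction.pinnedChain ω₂ lam β γ).bondCurrent N i x * U x ∂((Literature.MathematicalPhysics.KineticTheory.HeatConduction.pinnedChain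 ω₂ lam β γ).gibbsMeasure N T)) 0 :=
  fun _ _ _ _ hω hl hβ hγ _ hN _ hT μ hμ hA => det_of_apriori hω hl hβ hγ hN hT μ hμ hA

end Summit.AtomisticToContinuum.FouriersLaw.Theorems.NoiseLocality.StubResponseDensityNoisy

end
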